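import Literature.NumberTheory.PAdicHodge.TateAlmostEtaleLayer
import HarnessLib

/-!
# Tate's almost étale lemma — orbit sums over subgroups of a finite layer (descent to an arbitrary base)

Continuation of `TateAlmostEtaleLayer`.  There, for a finite normal layer `Ω = E(ζ_{p^n})` of `F̄/K₀`
with group `G = Gal(Ω/K₀)`, an integral generator `x` of `𝒪_Ω` and the stabiliser `H` of
`ζ = ζ_{p^n}`, every `h ∈ H ∖ 1` moves `x` by more than `U = ‖ζ_{p^{n−m}} − 1‖`.  Here we draw the
consequences needed to pass from the base `K₀(ζ_{p^n})` to an ARBITRARY subgroup `A ≤ G` (in the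
application: the image of the local Galois group `Γ_F ∩ (cyclotomic torsion)`), i.e. to traces down to the
fields `Ω^A ⊇ Ω^{A ⊔ H}`:

* `sum_eq_sum_quotient_sum_subgroup` : `Σ_{g ∈ G} f g = Σ_{q ∈ G/D} Σ_{d ∈ D} f (q.out d)` (additive
  form of `prod_eq_prod_quotient_prod_subgroup`);
* `norm_traceOneElt_mul_pow_le_one'` : for EVERY subgroup `D ≤ H` the Euler element
  `y_D = x^{|D|−1}/∏_{d ∈ D∖1}(x − d x)` has `Σ_{d∈D} d y_D = 1` and `‖y_D‖ · U^{|D|−1} ≤ 1`;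
* `orbitSum_smul_sum_eq` (**descent identity**): for `B, D ≤ A`, `λ` fixed by `A`, `ω` fixed by `D` and
  `Σ_{d ∈ D} d y = 1`, the element `Y = Σ_{b ∈ B} b (λ ω y)` is fixed by `B` and
  `Σ_{q ∈ A/B} q Y = λ · Σ_{s ∈ A/D} s ω` — the trace of `Y` from `Ω^B` to `Ω^A` is EXPLICIT;
* `norm_sum_subgroup_smul_le_one` : `Y` is integral as soon as `λ ω y` is.

With `D = A ∩ H` this reduces Tate's theorem over the fixed field of `A` to the evaluation of the
cyclotomic sum `Σ_{s ∈ A/(A∩H)} s ω`, `ω ∈ ℤ_p[ζ]` (file `TateAlmostEtaleCyclotomicSums`).  Finite group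
bookkeeping + the layer bound; no `sorry`, no definitions.

References: J. Tate, *p-divisible groups* (1967) §3.2 Prop. 9 [Tate1967]; J.-P. Serre, *Local Fields*
Ch. IV §1, Ch. III §6 Lemma 2 [SerreLocalFields1979].
-/

noncomputable section

open scoped Classical
open Polynomial Finset IntermediateField

namespace Literature.NumberTheory.PAdicHodge.TateAlmostEtale

/-! ## Additive coset decomposition -/

section Cosets

variable {G : Type*} [Group G] [Fintype G] {V : Type*} [AddCommMonoid V]

/-- **Coset decomposition of a sum**: `Σ_{g ∈ G} f g = Σ_{q ∈ G/D} Σ_{d ∈ D} f (q.out · d)` (Serre's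
grouping `Σ_{s∈G} = Σ_{σ∈G/H} Σ_{s→σ}`). [cite: SerreLocalFields1979, Ch. IV §1 Prop. 3 (coset bookkeeping of the proof)] -/
theorem sum_eq_sum_quotient_sum_subgroup (D : Subgroup G) (f : G → V) :
    ∑ g : G, f g = ∑ q : G ⧸ D, ∑ d : D, f (q.out * d) := by
  rw [← Fintype.sum_prod_type' (f := fun (q : G ⧸ D) (d : D) => f (q.out * d))]
  exact (Fintype.sum_bijective _ (bijective_out_mul D) (fun x => f (x.1.out * (x.2 : G))) f
    (fun _ => rfl)).symm

/-- Reindexing a sum over a subgroup along left multiplication by one of its elements.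
[cite: SerreLocalFields1979, Ch. IV §1 Prop. 3 (coset bookkeeping of the proof)] -/
theorem sum_subgroup_mul_left (D : Subgroup G) (f : G → V) {d₀ : G} (hd₀ : d₀ ∈ D) :
    ∑ d : D, f (d₀ * d) = ∑ d : D, f d :=
  Fintype.sum_equiv (Equiv.mulLeft ⟨d₀, hd₀⟩) _ _ fun d => by
    simp only [Equiv.coe_mulLeft, Subgroup.coe_mul]

end Cosets

/-! ## The layer: trace-one elements for subgroups of `Stab ζ`, and the descent identity -/

section Layer

open ValuativeRel CyclotomicTower
open Literature.NumberTheory.GaloisRepresentations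
open Literature.NumberTheory.GaloisRepresentations.IsNonarchimedeanLocalField

variable {F : Type} [Field F] [ValuativeRel F] [TopologicalSpace F] [IsNonarchimedeanLocalField F]
  [CharZero F] {p : ℕ} [Fact p.Prime] (hp : valuation F p < 1)
variable (Ω : IntermediateField (PadicBase F p hp) (NormedAlgClosure F))
  [FiniteDimensional (PadicBase F p hp) Ω] [Normal (PadicBase F p hp) Ω]

/-- **Almost integral trace-one elements for every subgroup `D` of `Stab ζ`.**  Under the hypotheses
of `gauge_gt_of_layer`, for `D ≤ H = Stab ζ` the Euler element `y_D = x^{|D|−1}/∏_{d∈D∖1}(x − dx)`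
(`Σ_{d∈D} d y_D = 1` by `sum_gal_traceOneElt_eq_one`) satisfies `‖y_D‖ · ‖ζ_{p^{n−m}} − 1‖^{|D|−1} ≤ 1`.
[cite: Tate1967, §3.2 Prop. 9 (proof)] [cite: SerreLocalFields1979, Ch. III §6 Lemma 2 (Euler)] -/
theorem norm_traceOneElt_mul_pow_le_one' {x : Ω} (hx : ‖(x : NormedAlgClosure F)‖ ≤ 1)
    (hfree : ∀ g : Ω ≃ₐ[PadicBase F p hp] Ω, g x = x → g = 1)
    {y₀ : Ω} (P : (PadicBase F p hp)[X]) (hP : ∀ j, ‖P.coeff j‖ ≤ 1) (hPy : aeval x P = y₀)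
    (C : Subgroup (Ω ≃ₐ[PadicBase F p hp] Ω)) (hC : ∀ g, g ∈ C ↔ g y₀ = y₀)
    {n : ℕ} {ζΩ : Ω} (hζ : (ζΩ : NormedAlgClosure F) = zeta F p n)
    (H : Subgroup (Ω ≃ₐ[PadicBase F p hp] Ω)) (hH : ∀ g, g ∈ H ↔ g ζΩ = ζΩ)
    (hHC : ∀ g : Ω ≃ₐ[PadicBase F p hp] Ω, g ζΩ = ζΩ → g y₀ = y₀ → g = 1)
    {J : ℝ} (hJ0 : 0 ≤ J) (hJ1 : J ≤ 1)
    (hJ : ∀ σ : Ω ≃ₐ[PadicBase F p hp] Ω, σ y₀ ≠ y₀ →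
      J ≤ ‖((σ y₀ : Ω) : NormedAlgClosure F) - y₀‖)
    {D' : ℕ} (hD' : Fintype.card ((Ω ≃ₐ[PadicBase F p hp] Ω) ⧸ C) ≤ D')
    {m : ℕ} (hm : 1 ≤ m) (hmn : m + 1 ≤ n)
    (hsmall : ‖(p : PadicBase F p hp)‖ ^ (m - 1) < J ^ D')
    (D : Subgroup (Ω ≃ₐ[PadicBase F p hp] Ω)) (hDH : D ≤ H) :
    ‖((x ^ (Fintype.card D - 1) /
          ∏ d ∈ (Finset.univ : Finset D).erase 1, (x - (d : Ω ≃ₐ[PadicBase F p hp] Ω) x) : Ω) :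
          NormedAlgClosure F)‖ *
        ‖zeta F p (n - m) - 1‖ ^ (Fintype.card D - 1) ≤ 1 := by
  set U₀ : ℝ := ‖zeta F p (n - m) - 1‖ with hU₀
  rw [norm_traceOneElt]
  have hcard : ((Finset.univ : Finset D).erase 1).card = Fintype.card D - 1 := by
    rw [Finset.card_erase_of_mem (Finset.mem_univ _), Finset.card_univ]
  have hU₀pos : 0 < U₀ := norm_zeta_sub_one_pos (by omega)
  have hden : U₀ ^ (Fintype.card D - 1) ≤
      ∏ d ∈ (Finset.univ : Finset D).erase 1,
        ‖(((d : Ω ≃ₐ[PadicBase F p hp] Ω) x : Ω) : NormedAlgClosure F) - x‖ := by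
    rw [← hcard, ← Finset.prod_const]
    refine Finset.prod_le_prod (fun _ _ => hU₀pos.le) fun d hd => le_of_lt ?_
    have hd1 : (d : Ω ≃ₐ[PadicBase F p hp] Ω) ≠ 1 := by
      intro e; exact (Finset.mem_erase.mp hd).1 (Subtype.ext e)
    exact gauge_gt_of_layer hp Ω hx hfree P hP hPy C hC hζ H hH hHC hJ0 hJ1 hJ hD' hm hmn hsmall
      (hDH d.2) hd1
  have hden_pos : 0 < ∏ d ∈ (Finset.univ : Finset D).erase 1,
      ‖(((d : Ω ≃ₐ[PadicBase F p hp] Ω) x : Ω) : NormedAlgClosure F) - x‖ :=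
    lt_of_lt_of_le (pow_pos hU₀pos _) hden
  rw [div_mul_eq_mul_div, div_le_one hden_pos]
  calc ‖(x : NormedAlgClosure F)‖ ^ (Fintype.card D - 1) * U₀ ^ (Fintype.card D - 1)
      ≤ 1 * U₀ ^ (Fintype.card D - 1) := by
        gcongr; exact pow_le_one₀ (norm_nonneg _) hx
    _ ≤ _ := by rw [one_mul]; exact hden

omit [FiniteDimensional (PadicBase F p hp) Ω] [Normal (PadicBase F p hp) Ω] in
/-- A sum over a subgroup `B` of `b w` is fixed by `B`. [cite: SerreLocalFields1979, Ch. IV §1 (trace to the fixed field)] -/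
theorem gal_sum_subgroup_eq [FiniteDimensional (PadicBase F p hp) Ω]
    (B : Subgroup (Ω ≃ₐ[PadicBase F p hp] Ω)) (w : Ω) {b₀ : Ω ≃ₐ[PadicBase F p hp] Ω}
    (hb₀ : b₀ ∈ B) :
    b₀ (∑ b : B, (b : Ω ≃ₐ[PadicBase F p hp] Ω) w) = ∑ b : B, (b : Ω ≃ₐ[PadicBase F p hp] Ω) w := by
  rw [map_sum]
  simp_rw [← AlgEquiv.mul_apply]
  exact sum_subgroup_mul_left B (fun g => g w) hb₀

omit [Normal (PadicBase F p hp) Ω] in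
/-- **The descent identity.**  Let `B, D ≤ A ≤ Gal(Ω/K₀)`, `λ` fixed by `A`, `ω` fixed by `D`, and
`y` with `Σ_{d ∈ D} d y = 1`.  Then for `Y = Σ_{b ∈ B} b (λ ω y)`:
`Σ_{q ∈ A/B} q.out Y = λ · Σ_{s ∈ A/D} s.out ω` — the trace from `Ω^B` to `Ω^A` of `Y` is `λ` times the
explicit orbit sum of `ω`.  (Group the `A`-sum along `D`-cosets: `Σ_{a∈A} a(λωy) = Σ_s s(λω Σ_d d y)`.)
[cite: SerreLocalFields1979, Ch. IV §1 Prop. 3 (coset bookkeeping); Ch. III §6 Lemma 2] -/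
theorem orbitSum_smul_sum_eq (A B D : Subgroup (Ω ≃ₐ[PadicBase F p hp] Ω)) (hBA : B ≤ A) (hDA : D ≤ A)
    {lam ω y : Ω} (hlam : ∀ a ∈ A, a lam = lam) (hω : ∀ d ∈ D, d ω = ω)
    (hy : ∑ d : D, (d : Ω ≃ₐ[PadicBase F p hp] Ω) y = 1) :
    ∑ q : A ⧸ B.subgroupOf A, ((q.out : A) : Ω ≃ₐ[PadicBase F p hp] Ω)
        (∑ b : B, (b : Ω ≃ₐ[PadicBase F p hp] Ω) (lam * ω * y)) =
      lam * ∑ s : A ⧸ D.subgroupOf A, ((s.out : A) : Ω ≃ₐ[PadicBase F p hp] Ω) ω := by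
  set w : Ω := lam * ω * y with hw
  -- both sides as sums over `A`
  have hL : ∑ q : A ⧸ B.subgroupOf A, ((q.out : A) : Ω ≃ₐ[PadicBase F p hp] Ω)
      (∑ b : B, (b : Ω ≃ₐ[PadicBase F p hp] Ω) w) = ∑ a : A, (a : Ω ≃ₐ[PadicBase F p hp] Ω) w := by
    rw [sum_eq_sum_quotient_sum_subgroup (B.subgroupOf A) (fun a : A => (a : Ω ≃ₐ[PadicBase F p hp] Ω) w)]
    refine Finset.sum_congr rfl fun q _ => ?_
    rw [map_sum]
    -- `Σ_{b : B} (q.out b) w = Σ_{d : B.subgroupOf A} (q.out d) w`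
    refine Fintype.sum_equiv ((B.subgroupOfEquivOfLe hBA).symm.toEquiv) _ _ fun b => ?_
    rw [← AlgEquiv.mul_apply]
    rfl
  have hR : ∑ a : A, (a : Ω ≃ₐ[PadicBase F p hp] Ω) w =
      lam * ∑ s : A ⧸ D.subgroupOf A, ((s.out : A) : Ω ≃ₐ[PadicBase F p hp] Ω) ω := by
    rw [sum_eq_sum_quotient_sum_subgroup (D.subgroupOf A) (fun a : A => (a : Ω ≃ₐ[PadicBase F p hp] Ω) w),
      Finset.mul_sum]
    refine Finset.sum_congr rfl fun s _ => ?_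
    have hs : ∀ d : D.subgroupOf A, (((s.out * d : A) : Ω ≃ₐ[PadicBase F p hp] Ω)) w =
        ((s.out : A) : Ω ≃ₐ[PadicBase F p hp] Ω) (lam * ω * (((d : A) : Ω ≃ₐ[PadicBase F p hp] Ω) y)) := by
      intro d
      have hdD : ((d : A) : Ω ≃ₐ[PadicBase F p hp] Ω) ∈ D := Subgroup.mem_subgroupOf.mp d.2
      rw [Subgroup.coe_mul, AlgEquiv.mul_apply, hw]
      simp only [map_mul]
      rw [hω _ hdD, hlam _ (hDA hdD)]
    simp_rw [hs, ← map_sum (((s.out : A) : Ω ≃ₐ[PadicBase F p hp] Ω)), ← Finset.mul_sum]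
    -- `Σ_{d : D.subgroupOf A} d y = Σ_{d : D} d y = 1`
    have hy' : ∑ d : D.subgroupOf A, (((d : A) : Ω ≃ₐ[PadicBase F p hp] Ω)) y = 1 := by
      rw [← hy]
      exact Fintype.sum_equiv (D.subgroupOfEquivOfLe hDA).toEquiv _ _ fun d => rfl
    rw [hy', mul_one, map_mul, hlam _ (s.out).2]
  rw [hL, hR]

omit [Normal (PadicBase F p hp) Ω] in
/-- The sum `Σ_{b ∈ B} b w` is integral when `w` is. [cite: SerreLocalFields1979, Ch. IV §1 (the Galois group preserves the integers)] -/
theorem norm_sum_subgroup_le_one [Normal (PadicBase F p hp) Ω] (B : Subgroup (Ω ≃ₐ[PadicBase F p hp] Ω))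
    {w : Ω} (hw : ‖(w : NormedAlgClosure F)‖ ≤ 1) :
    ‖((∑ b : B, (b : Ω ≃ₐ[PadicBase F p hp] Ω) w : Ω) : NormedAlgClosure F)‖ ≤ 1 := by
  push_cast
  refine IsUltrametricDist.norm_sum_le_of_forall_le_of_nonneg zero_le_one fun b _ => ?_
  rw [norm_coe_gal]; exact hw

end Layer

end Literature.NumberTheory.PAdicHodge.TateAlmostEtale

end
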